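import Mathlib
import Summits.RiemannHypothesis.RiemannHypothesis.Theorems.WeilFarFloorCouplingTransfer
import Summits.RiemannHypothesis.RiemannHypothesis.Theorems.WeilFarFloorProfileDecomposition
import Summits.RiemannHypothesis.RiemannHypothesis.Theorems.WeilFarFloorSmoothProfile
import Summits.RiemannHypothesis.RiemannHypothesis.Theorems.WeilFarFloorResidualArch
import HarnessLib

/-!
# The pieces of the C-XIII″ core estimate (RH-free bookkeeping around a mollified cosh profile)

Helper file (`--supports stmt-RiemannHypothesis-0098`, lead-track anchor: Weil-positivity window ladder, format-C far bound),
pure proofs, RH-free.  Seat rh-explicit-weil-1 gen13 (memo `run/shared/lean/pub/rh-explicit/rh-explicit-weil-1/FORMAT-K3.md` §14;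
recipe §13.7 of gen12).  Companion of `WeilFarFloorCoshOptimalCoreRH` (the RH step) and `WeilFarFloorCoshOptimalRH` (the floor theorem
«under RH, λ_max(a) − R_c(a) → 0»).

SETTING.  `u` admissible on `[−b₂, b₂]` (the near-extremal), `C = cosh(·/2)·1_{[−b₁,b₁]}` the cosh profile (`‖C‖² = P₁ = b₁ + sinh b₁`),
`C_m` its mollification at radius `s²` (`exists_smoothProfile`: admissible on `[−b₂, b₂]`, `b₂ = b₁ + s²`, `‖C − C_m‖ ≤ (3/2)s‖C‖`),
`c = ⟨u, C_m⟩/‖C_m‖²`, `r = u − c·C_m`.  The RH anatomy (`WeilFarFloorCoshComponentRH`) bounds `Q(u)` by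
`c²Q(C_m) + 2c∫(T C_m)r + 2⟨r,cosh(·/2)⟩² − K‖r‖² + ARCH(r)`; this file bounds the pieces, all RH-free and each a standalone theorem
(so that every declaration elaborates on default heartbeats):
* `profile_term_le` : `Q_{b₂}(C_m) ≤ (R_c(b₁) + 6Ws)‖C_m‖²` (`W ≥ Σ_{log n<2b₂} 2Λ(n)/√n`; Rayleigh-quotient Lipschitz bound);
* `coupling_term_le` : `2c∫(T_{b₂}C_m)r ≤ η∫u² + 2(2J_c + 5s²(2W+τ)²)‖r‖²/η` from a coupling budget
  `∫_{(−b₁,b₁)}(T_{b₁}C − (e^{b₁}+b₁)C)² ≤ J_c‖C‖²` (coupling transfer `abs_integral_primeShiftOp_mul_le`, `τ ≥ e^{b₁} + b₁`);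
* `pole_term_le` : `⟨r,cosh(·/2)⟩² ≤ 8s²P₊‖r‖²` (`P₊ ≥ b₂ + sinh b₂`);
* `arch_term_le` : `ARCH(r) ≤ 10ηN + 4Ψ(ηh)‖r‖²` for `u` in the linear-modulus class `D_t(u) ≤ (|t|/h)N`;
* `profile_norm_ge_half` : `‖C‖² ≤ 2‖C_m‖²` (`s ≤ 1/6`);  `residual_energy_le` : `‖r‖² ≤ (∫u² − ⟨u,C⟩²/‖C‖²) + (9/2)s∫u²`;
* `core_bookkeeping` : the final real arithmetic (dichotomy `Q(u) ≤ R_c∫u²` or rigidity), and two scalar helpers.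
Standard axioms only.
-/

set_option linter.dupNamespace false
set_option autoImplicit false

noncomputable section

open MeasureTheory Set Filter
open scoped Real Topology ArithmeticFunction.vonMangoldt

namespace Summit.RiemannHypothesis.RiemannHypothesis.Theorems.WeilFormatC

namespace FloorCoshSplit

open Literature.NumberTheory.LFunctions FloorCosh FloorEnvelope

/-! ## §1 Scalar bookkeeping -/

/-- **The bookkeeping of the core estimate** (pure real arithmetic; the letters are those of the file header). -/
theorem core_bookkeeping {N Nu Pm P₁ R Q QCm c X Po ρr ARCH K η W s Jsq Pp Ψ Γ ρ₀ m₁ S ceil : ℝ}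
    (hN : Nu ≤ N) (hNu0 : 0 ≤ Nu) (hP₁0 : 0 < P₁) (hR0 : 0 ≤ R) (hη0 : 0 < η) (hK0 : 0 ≤ K)
    (hW0 : 0 ≤ W) (hs0 : 0 ≤ s) (hJsq0 : 0 ≤ Jsq) (hPp0 : 0 ≤ Pp) (hΨ0 : 0 ≤ Ψ) (hΓ0 : 0 ≤ Γ)
    (F1 : Q ≤ c ^ 2 * QCm + 2 * c * X + 2 * Po ^ 2 - K * ρr + ARCH)
    (F2 : c ^ 2 * Pm ≤ Nu) (hρr0 : 0 ≤ ρr)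
    (F3 : QCm ≤ (R + 6 * W * s) * Pm)
    (F4 : 2 * c * X ≤ η * Nu + 2 * Jsq * ρr / η)
    (F5 : Po ^ 2 ≤ ρr * (8 * s ^ 2 * Pp))
    (F6 : ARCH ≤ 10 * η * N + 4 * Ψ * ρr)
    (F8 : S * (Nu - m₁) ≤ ceil * Nu + η * N - Q) (hS : P₁ ≤ S) (hceil : ceil - R ≤ Γ)
    (F9 : ρr ≤ (Nu - m₁) + 9 / 2 * s * Nu)
    (hρ₀ : (Γ + 1) / P₁ + 5 * s ≤ ρ₀)
    (hS1 : 6 * W * s ≤ η) (hη1 : η ≤ 1)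
    (hS2 : ρ₀ * (2 * Jsq / η + 16 * s ^ 2 * Pp + 4 * Ψ) ≤ η) :
    Q ≤ (R + 13 * η) * N := by
  have hN0 : 0 ≤ N := hNu0.trans hN
  have hc2 : 0 ≤ c ^ 2 := sq_nonneg c
  -- the profile component
  have hprof : c ^ 2 * QCm ≤ (R + 6 * W * s) * Nu := by
    have h1 : c ^ 2 * QCm ≤ c ^ 2 * ((R + 6 * W * s) * Pm) := mul_le_mul_of_nonneg_left F3 hc2
    have h2 : (R + 6 * W * s) * (c ^ 2 * Pm) ≤ (R + 6 * W * s) * Nu :=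
      mul_le_mul_of_nonneg_left F2 (by positivity)
    linarith
  -- the residual terms collected: `Q ≤ (R + 6Ws + η)Nu + 10ηN + ρr·E`
  set E := 2 * Jsq / η + 16 * s ^ 2 * Pp + 4 * Ψ with hE
  have hE0 : 0 ≤ E := by positivity
  have hmain : Q ≤ (R + 6 * W * s + η) * Nu + 10 * η * N + ρr * E := by
    have h5 : 2 * Po ^ 2 ≤ ρr * (16 * s ^ 2 * Pp) := by linarith
    have hK : -(K * ρr) ≤ 0 := by have := mul_nonneg hK0 hρr0; linarith
    have e : ρr * E = 2 * Jsq * ρr / η + ρr * (16 * s ^ 2 * Pp) + 4 * Ψ * ρr := by rw [hE]; ring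
    linarith
  by_cases hQ : Q ≤ R * Nu
  · -- case A: trivial
    have h1 : R * Nu ≤ R * N := mul_le_mul_of_nonneg_left hN hR0
    have h2 : 0 ≤ 13 * η * N := by positivity
    linarith
  · -- case B: rigidity makes the residual small
    push Not at hQ
    have hdef : S * (Nu - m₁) ≤ (Γ + η) * N := by
      have h1 : ceil * Nu - Q ≤ (ceil - R) * Nu := by linarith
      have h2 : (ceil - R) * Nu ≤ Γ * Nu := mul_le_mul_of_nonneg_right hceil hNu0
      have h3 : Γ * Nu ≤ Γ * N := mul_le_mul_of_nonneg_left hN hΓ0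
      have h4 : η * N ≤ η * N := le_rfl
      linarith
    have ht : Nu - m₁ ≤ (Γ + 1) / P₁ * N := by
      have hΓη : (Γ + η) * N ≤ (Γ + 1) * N := mul_le_mul_of_nonneg_right (by linarith) hN0
      rcases le_or_gt 0 (Nu - m₁) with hpos | hneg
      · have h1 : P₁ * (Nu - m₁) ≤ S * (Nu - m₁) := mul_le_mul_of_nonneg_right hS hpos
        rw [div_mul_eq_mul_div, le_div_iff₀ hP₁0]
        linarith
      · have : 0 ≤ (Γ + 1) / P₁ * N := by positivity
        linarith
    have hρ : ρr ≤ ρ₀ * N := by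
      have h1 : 9 / 2 * s * Nu ≤ 5 * s * N := by nlinarith
      have h2 : ((Γ + 1) / P₁ + 5 * s) * N ≤ ρ₀ * N := mul_le_mul_of_nonneg_right hρ₀ hN0
      linarith
    have hρE : ρr * E ≤ η * N := by
      have h1 : ρr * E ≤ ρ₀ * N * E := mul_le_mul_of_nonneg_right hρ hE0
      have h2 : ρ₀ * N * E = (ρ₀ * E) * N := by ring
      have h3 : (ρ₀ * E) * N ≤ η * N := mul_le_mul_of_nonneg_right (by rw [hE]; exact hS2) hN0
      linarith
    have hcoef : (R + 6 * W * s + η) * Nu ≤ (R + 6 * W * s + η) * N :=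
      mul_le_mul_of_nonneg_left hN (by positivity)
    have h6 : 6 * W * s * N ≤ η * N := mul_le_mul_of_nonneg_right hS1 hN0
    linarith

/-- `cosh(b/2) ≤ √(b + sinh b)` for `b ≥ 1` (`cosh²(b/2) = (1 + cosh b)/2 ≤ (2 + sinh b)/2`). -/
theorem cosh_half_le_sqrt {b : ℝ} (hb : 1 ≤ b) : Real.cosh (b / 2) ≤ Real.sqrt (b + Real.sinh b) := by
  have hsq : Real.cosh (b / 2) ^ 2 ≤ b + Real.sinh b := by
    have h1 : Real.cosh b = Real.cosh (b / 2) ^ 2 + Real.sinh (b / 2) ^ 2 := by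
      rw [← Real.cosh_two_mul]; ring_nf
    have h2 : Real.cosh (b / 2) ^ 2 = Real.sinh (b / 2) ^ 2 + 1 := Real.cosh_sq _
    have h3 : Real.cosh b = Real.sinh b + Real.exp (-b) := by rw [Real.cosh_eq, Real.sinh_eq]; ring
    have h4 : Real.exp (-b) ≤ 1 := Real.exp_le_one_iff.2 (by linarith)
    nlinarith
  calc Real.cosh (b / 2) = Real.sqrt (Real.cosh (b / 2) ^ 2) := (Real.sqrt_sq (Real.cosh_pos _).le).symm
    _ ≤ Real.sqrt (b + Real.sinh b) := Real.sqrt_le_sqrt hsq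

/-- `√d ≤ (3/2)·s·√P` whenever `d ≤ (P + 3)s²` and `P ≥ 3` (then `P + 3 ≤ (9/4)P`). -/
theorem sqrt_le_of_le_mul_sq {d P s : ℝ} (hP : 3 ≤ P) (hs : 0 ≤ s) (hd : d ≤ (P + 3) * s ^ 2) :
    Real.sqrt d ≤ 3 / 2 * s * Real.sqrt P := by
  have h1 : d ≤ (3 / 2 * s) ^ 2 * P := by nlinarith [sq_nonneg s]
  calc Real.sqrt d ≤ Real.sqrt ((3 / 2 * s) ^ 2 * P) := Real.sqrt_le_sqrt h1
    _ = 3 / 2 * s * Real.sqrt P := by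
        rw [Real.sqrt_mul (sq_nonneg _), Real.sqrt_sq (by positivity)]

/-! ## §2 The five pieces of the core estimate (standalone, so that each elaborates on default heartbeats) -/

section Pieces

variable {b₁ b₂ s η h W τ Jc P₁ Pm Nu N Pp c : ℝ} {u C Cm : ℝ → ℝ} {Cu CC CCm : ℝ}

/-- PIECE (2): **the profile component**, `Q_{b₂}(C_m) ≤ (R_c(b₁) + 6Ws)·‖C_m‖²` — the Rayleigh quotient is `L²`-Lipschitz
(`abs_primeShiftQuotient_sub_le`) and `‖C − C_m‖ ≤ (3/2)s‖C‖`. -/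
theorem profile_term_le (hb₁₂ : b₁ ≤ b₂) (hs0 : 0 ≤ s) (hP₁0 : 0 < P₁) (hW0 : 0 ≤ W)
    (hC : Measurable C) (hCb : ∀ x, |C x| ≤ CC) (hCs : ∀ x, x ∉ Icc (-b₁) b₁ → C x = 0)
    (hCm : Measurable Cm) (hCmb : ∀ x, |Cm x| ≤ CCm) (hCms : ∀ x, x ∉ Icc (-b₂) b₂ → Cm x = 0)
    (hCP : ∫ x, C x ^ 2 = P₁) (hPm0 : 0 < ∫ x, Cm x ^ 2) (hCmN : ∫ x, Cm x ^ 2 ≤ ∫ x, C x ^ 2)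
    (hsqd : Real.sqrt (∫ x, (C x - Cm x) ^ 2) ≤ 3 / 2 * s * Real.sqrt P₁)
    (hW : ∑ n ∈ weilPrimeIndex b₂, 2 * ((Λ n : ℝ) / Real.sqrt n) ≤ W) :
    primeShiftForm b₂ Cm ≤ (primeShiftForm b₁ C / P₁ + 6 * W * s) * ∫ x, Cm x ^ 2 := by
  have hCs₂ : ∀ x, x ∉ Icc (-b₂) b₂ → C x = 0 := fun x hx ↦ hCs x fun hm ↦ hx
    ⟨by linarith only [hm.1, hb₁₂], by linarith only [hm.2, hb₁₂]⟩
  have hq := abs_primeShiftQuotient_sub_le (B := b₂) hC hCm hCb hCmb hCs₂ hCms hPm0 hCmN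
  rw [hCP] at hq
  have hQC : primeShiftForm b₂ C = primeShiftForm b₁ C := (WeilFormatC.primeShiftForm_eq_of_le hb₁₂ hCs).symm
  rw [hQC] at hq
  have hPmP : ∫ x, Cm x ^ 2 ≤ P₁ := by rw [← hCP]; exact hCmN
  have hsP : 0 < Real.sqrt P₁ := Real.sqrt_pos.2 hP₁0
  have hsPsq : Real.sqrt P₁ * Real.sqrt P₁ = P₁ := Real.mul_self_sqrt hP₁0.le
  have herr : 2 * (∑ n ∈ weilPrimeIndex b₂, 2 * ((Λ n : ℝ) / Real.sqrt n))
      * (Real.sqrt (∫ x, (C x - Cm x) ^ 2) * (Real.sqrt P₁ + Real.sqrt (∫ x, Cm x ^ 2))) / P₁ ≤ 6 * W * s := by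
    have hPmle : Real.sqrt (∫ x, Cm x ^ 2) ≤ Real.sqrt P₁ := Real.sqrt_le_sqrt hPmP
    have h1 : Real.sqrt (∫ x, (C x - Cm x) ^ 2) * (Real.sqrt P₁ + Real.sqrt (∫ x, Cm x ^ 2)) ≤ 3 * s * P₁ := by
      calc Real.sqrt (∫ x, (C x - Cm x) ^ 2) * (Real.sqrt P₁ + Real.sqrt (∫ x, Cm x ^ 2))
          ≤ (3 / 2 * s * Real.sqrt P₁) * (2 * Real.sqrt P₁) :=
            mul_le_mul hsqd (by linarith only [hPmle]) (by positivity) (by positivity)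
        _ = 3 * s * (Real.sqrt P₁ * Real.sqrt P₁) := by ring
        _ = 3 * s * P₁ := by rw [hsPsq]
    rw [div_le_iff₀ hP₁0]
    have h2 := mul_le_mul hW h1 (by positivity) hW0
    nlinarith only [h2, hP₁0, hW0, hs0]
  have h3 := (abs_sub_le_iff.1 hq).2
  have h4 : primeShiftForm b₂ Cm / ∫ x, Cm x ^ 2 ≤ primeShiftForm b₁ C / P₁ + 6 * W * s := by linarith only [h3, herr]
  rwa [div_le_iff₀ hPm0] at h4

/-- PIECE (3): **the coupling**, `2c∫(T_{b₂}C_m)·r ≤ η∫u² + 2J·‖r‖²/η` with `J = 2J_c + 5s²(2W + τ)²` — coupling transfer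
(`abs_integral_primeShiftOp_mul_le`) from the stage-1 bound `∫_{(−b₁,b₁)}(T_{b₁}C − (e^{b₁}+b₁)C)² ≤ J_c‖C‖²`, then `2xy ≤ ηx² + y²/η`. -/
theorem coupling_term_le (hb₁1 : 1 ≤ b₁) (hb₂ : b₂ = b₁ + s ^ 2) (hs0 : 0 < s) (hη0 : 0 < η) (hW0 : 0 ≤ W)
    (hτ : Real.exp b₁ + b₁ ≤ τ) (hJc : 0 ≤ Jc) (hP₁ : P₁ = b₁ + Real.sinh b₁) (hP₁0 : 0 < P₁)
    (hC : Measurable C) (hCb : ∀ x, |C x| ≤ Real.cosh (b₁ / 2)) (hCs : ∀ x, x ∉ Icc (-b₁) b₁ → C x = 0)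
    (hCm : Measurable Cm) (hCmb : ∀ x, |Cm x| ≤ CCm) (hCms : ∀ x, x ∉ Icc (-b₂) b₂ → Cm x = 0)
    (hu : Measurable u) (hCu : ∀ x, |u x| ≤ Cu) (hus : ∀ x, x ∉ Icc (-b₂) b₂ → u x = 0)
    (horth : ∫ x, Cm x * (u x - c * Cm x) = 0)
    (hW : ∑ n ∈ weilPrimeIndex b₂, 2 * ((Λ n : ℝ) / Real.sqrt n) ≤ W)
    (hcoup : ∫ x in Ioo (-b₁) b₁,
        ((∑ n ∈ weilPrimeIndex b₁, (Λ n : ℝ) / Real.sqrt n * (C (x - Real.log n) + C (x + Real.log n)))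
          - (Real.exp b₁ + b₁) * C x) ^ 2 ≤ Jc * P₁)
    (hsqd : Real.sqrt (∫ x, (Cm x - C x) ^ 2) ≤ 3 / 2 * s * Real.sqrt P₁)
    (hPm0 : 0 < Pm) (hPm2 : P₁ ≤ 2 * Pm) (hBes : c ^ 2 * Pm ≤ Nu) :
    2 * c * (∫ x, (∑ n ∈ weilPrimeIndex b₂, (Λ n : ℝ) / Real.sqrt n
        * (Cm (x - Real.log n) + Cm (x + Real.log n))) * (u x - c * Cm x))
      ≤ η * Nu + 2 * (2 * Jc + 5 * s ^ 2 * (2 * W + τ) ^ 2) * (∫ x, (u x - c * Cm x) ^ 2) / η := by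
  have hb₁₂ : b₁ ≤ b₂ := by rw [hb₂]; linarith only [sq_nonneg s]
  have hτ0 : 0 ≤ τ := le_trans (by positivity) hτ
  obtain ⟨hrm, hrb, hrs⟩ := residual_admissible (B := b₂) hu hCm hCu hCmb hus hCms c
  have hct := abs_integral_primeShiftOp_mul_le (b := b₁) (b' := b₂) hb₁₂ hC hCb hCs hCm hCmb hCms hrm hrb hrs horth
    (Real.exp b₁ + b₁)
  have hA₂W : 2 * (∑ n ∈ weilPrimeIndex b₂, (Λ n : ℝ) / Real.sqrt n) ≤ W := by
    rw [Finset.mul_sum]; exact hW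
  -- sizes of the three pieces of the coupling bracket
  have hcoupS : Real.sqrt (∫ x in Ioo (-b₁) b₁, ((∑ n ∈ weilPrimeIndex b₁, (Λ n : ℝ) / Real.sqrt n *
          (C (x - Real.log n) + C (x + Real.log n))) - (Real.exp b₁ + b₁) * C x) ^ 2)
      ≤ Real.sqrt (Jc * P₁) := Real.sqrt_le_sqrt hcoup
  have hb₂₁ : Real.sqrt (2 * (b₂ - b₁)) ≤ 3 / 2 * s := by
    rw [show 2 * (b₂ - b₁) = 2 * s ^ 2 by rw [hb₂]; ring]
    rw [Real.sqrt_le_left (by positivity)]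
    nlinarith only [hs0]
  have hcosh : Real.cosh (b₁ / 2) ≤ Real.sqrt P₁ := by rw [hP₁]; exact cosh_half_le_sqrt hb₁1
  have habsτ : |Real.exp b₁ + b₁| = Real.exp b₁ + b₁ := abs_of_pos (by positivity)
  rw [habsτ] at hct
  have h1 : (2 * (∑ n ∈ weilPrimeIndex b₂, (Λ n : ℝ) / Real.sqrt n) + (Real.exp b₁ + b₁))
      * Real.sqrt (∫ x, (Cm x - C x) ^ 2) ≤ (W + τ) * (3 / 2 * s * Real.sqrt P₁) :=
    mul_le_mul (by linarith only [hA₂W, hτ]) hsqd (Real.sqrt_nonneg _) (by positivity)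
  have h2 : 2 * (∑ n ∈ weilPrimeIndex b₂, (Λ n : ℝ) / Real.sqrt n) * Real.cosh (b₁ / 2) * Real.sqrt (2 * (b₂ - b₁))
      ≤ W * Real.sqrt P₁ * (3 / 2 * s) :=
    mul_le_mul (mul_le_mul hA₂W hcosh (Real.cosh_pos _).le hW0) hb₂₁ (Real.sqrt_nonneg _) (by positivity)
  -- name the bracket `Bx` and the coupling integral `X`
  generalize hBx : Real.sqrt (∫ x in Ioo (-b₁) b₁, ((∑ n ∈ weilPrimeIndex b₁, (Λ n : ℝ) / Real.sqrt n *
          (C (x - Real.log n) + C (x + Real.log n))) - (Real.exp b₁ + b₁) * C x) ^ 2)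
        + (2 * (∑ n ∈ weilPrimeIndex b₂, (Λ n : ℝ) / Real.sqrt n) + (Real.exp b₁ + b₁))
          * Real.sqrt (∫ x, (Cm x - C x) ^ 2)
        + 2 * (∑ n ∈ weilPrimeIndex b₂, (Λ n : ℝ) / Real.sqrt n) * Real.cosh (b₁ / 2)
          * Real.sqrt (2 * (b₂ - b₁)) = Bx at hct
  have hBx1 : Bx ≤ Real.sqrt (Jc * P₁) + 3 / 2 * s * (2 * W + τ) * Real.sqrt P₁ := by
    rw [← hBx]
    have e : (W + τ) * (3 / 2 * s * Real.sqrt P₁) + W * Real.sqrt P₁ * (3 / 2 * s)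
        = 3 / 2 * s * (2 * W + τ) * Real.sqrt P₁ := by ring
    linarith only [hcoupS, h1, h2, e]
  have hBx0 : 0 ≤ Bx := by rw [← hBx]; positivity
  clear h1 h2 hcoupS hb₂₁ hcosh hBx
  generalize hX : (∫ x, (∑ n ∈ weilPrimeIndex b₂, (Λ n : ℝ) / Real.sqrt n
      * (Cm (x - Real.log n) + Cm (x + Real.log n))) * (u x - c * Cm x)) = X at hct ⊢
  generalize hρr : (∫ x, (u x - c * Cm x) ^ 2) = ρr at hct ⊢
  have hρr0 : 0 ≤ ρr := by rw [← hρr]; exact integral_nonneg fun x ↦ sq_nonneg _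
  set Jsq := 2 * Jc + 5 * s ^ 2 * (2 * W + τ) ^ 2 with hJsq
  have hJsq0 : 0 ≤ Jsq := by rw [hJsq]; positivity
  -- `Bx² ≤ P₁·Jsq`
  have hBx2 : Bx ^ 2 ≤ P₁ * Jsq := by
    have h1 : Bx ^ 2 ≤ 2 * Real.sqrt (Jc * P₁) ^ 2 + 2 * (3 / 2 * s * (2 * W + τ) * Real.sqrt P₁) ^ 2 := by
      have h0 := pow_le_pow_left₀ hBx0 hBx1 2
      nlinarith only [h0, sq_nonneg (Real.sqrt (Jc * P₁) - 3 / 2 * s * (2 * W + τ) * Real.sqrt P₁)]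
    have h2 : Real.sqrt (Jc * P₁) ^ 2 = Jc * P₁ := Real.sq_sqrt (by positivity)
    have h3 : (3 / 2 * s * (2 * W + τ) * Real.sqrt P₁) ^ 2 = 9 / 4 * s ^ 2 * (2 * W + τ) ^ 2 * P₁ := by
      rw [mul_pow, Real.sq_sqrt hP₁0.le]; ring
    rw [h2, h3] at h1
    have h4 : 0 ≤ s ^ 2 * (2 * W + τ) ^ 2 * P₁ := by positivity
    have e : P₁ * Jsq = 2 * (Jc * P₁) + 5 * (s ^ 2 * (2 * W + τ) ^ 2 * P₁) := by rw [hJsq]; ring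
    rw [e]; linarith only [h1, h4]
  -- `2cX ≤ 2(|c|√Pm)(Bx√ρr/√Pm) ≤ η c²Pm + Bx²ρr/(η Pm) ≤ η∫u² + 2Jsq ρr/η`
  have hsρ : Real.sqrt ρr ^ 2 = ρr := Real.sq_sqrt hρr0
  have hsPm : Real.sqrt Pm ^ 2 = Pm := Real.sq_sqrt hPm0.le
  have hsPm0 : 0 < Real.sqrt Pm := Real.sqrt_pos.2 hPm0
  have h1 : 2 * c * X ≤ 2 * (|c| * Real.sqrt Pm) * (Bx * Real.sqrt ρr / Real.sqrt Pm) := by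
    have e : 2 * (|c| * Real.sqrt Pm) * (Bx * Real.sqrt ρr / Real.sqrt Pm) = 2 * (|c| * (Bx * Real.sqrt ρr)) := by
      field_simp
    rw [e]
    have h2 : c * X ≤ |c| * |X| := by
      calc c * X ≤ |c * X| := le_abs_self _
        _ = |c| * |X| := abs_mul _ _
    have h3 : |c| * |X| ≤ |c| * (Bx * Real.sqrt ρr) := mul_le_mul_of_nonneg_left hct (abs_nonneg c)
    linarith only [h2, h3]
  have h2 : 2 * (|c| * Real.sqrt Pm) * (Bx * Real.sqrt ρr / Real.sqrt Pm)
      ≤ η * (|c| * Real.sqrt Pm) ^ 2 + (Bx * Real.sqrt ρr / Real.sqrt Pm) ^ 2 / η := by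
    -- Young: `2xy ≤ ηx² + y²/η`
    have hy : 0 ≤ (η * (|c| * Real.sqrt Pm) - Bx * Real.sqrt ρr / Real.sqrt Pm) ^ 2 / η := div_nonneg (sq_nonneg _) hη0.le
    have hy2 : (η * (|c| * Real.sqrt Pm) - Bx * Real.sqrt ρr / Real.sqrt Pm) ^ 2 / η
        = η * (|c| * Real.sqrt Pm) ^ 2 - 2 * (|c| * Real.sqrt Pm) * (Bx * Real.sqrt ρr / Real.sqrt Pm)
          + (Bx * Real.sqrt ρr / Real.sqrt Pm) ^ 2 / η := by
      field_simp; ring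
    linarith only [hy, hy2]
  have h3 : η * (|c| * Real.sqrt Pm) ^ 2 ≤ η * Nu := by
    rw [mul_pow, sq_abs, hsPm]; exact mul_le_mul_of_nonneg_left hBes hη0.le
  have h4 : (Bx * Real.sqrt ρr / Real.sqrt Pm) ^ 2 / η ≤ 2 * Jsq * ρr / η := by
    refine div_le_div_of_nonneg_right ?_ hη0.le
    rw [div_pow, mul_pow, hsρ, hsPm, div_le_iff₀ hPm0]
    have h5 := mul_le_mul_of_nonneg_right hBx2 hρr0
    have h6 : P₁ * Jsq * ρr ≤ 2 * Jsq * ρr * Pm := by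
      have := mul_le_mul_of_nonneg_right hPm2 (mul_nonneg hJsq0 hρr0)
      nlinarith only [this]
    linarith only [h5, h6]
  linarith only [h1, h2, h3, h4]

/-- PIECE: **the pole term of the residual**, `(∫ r·cosh(·/2))² ≤ ‖r‖²·8s²P₊` — `⟨r, C_{b₂}⟩ = ⟨r, C_{b₂} − C_m⟩`
(`sq_integral_residual_mul_cosh_le`) and `‖C_{b₂} − C_m‖² ≤ 2‖C_{b₂} − C_{b₁}‖² + 2‖C_{b₁} − C_m‖²`. -/
theorem pole_term_le (hb₁1 : 1 ≤ b₁) (hb₂ : b₂ = b₁ + s ^ 2) (hP₁ : P₁ = b₁ + Real.sinh b₁) (hP₁3 : 3 ≤ P₁)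
    (hPp : b₂ + Real.sinh b₂ ≤ Pp) (hCm : Measurable Cm) (hCmb : ∀ x, |Cm x| ≤ CCm)
    (hCms : ∀ x, x ∉ Icc (-b₂) b₂ → Cm x = 0) (hu : Measurable u) (hCu : ∀ x, |u x| ≤ Cu)
    (hus : ∀ x, x ∉ Icc (-b₂) b₂ → u x = 0) (hPmne : (∫ x, Cm x ^ 2) ≠ 0)
    (hdist' : ∫ x, ((Icc (-b₁) b₁).indicator (fun y ↦ Real.cosh (y / 2)) x - Cm x) ^ 2 ≤ (P₁ + 3) * s ^ 2) :
    (∫ t, (u t - (∫ y, u y * Cm y) / (∫ y, Cm y ^ 2) * Cm t) * Real.cosh (t / 2)) ^ 2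
      ≤ (∫ x, (u x - (∫ y, u y * Cm y) / (∫ y, Cm y ^ 2) * Cm x) ^ 2) * (8 * s ^ 2 * Pp) := by
  have hs2 : 0 ≤ s ^ 2 := sq_nonneg s
  have hb₁₂ : b₁ ≤ b₂ := by rw [hb₂]; linarith only [hs2]
  have h1 := sq_integral_residual_mul_cosh_le (B := b₂) hu hCm hCu hCmb hus hCms hPmne
  obtain ⟨hCm_, hCb, hCs⟩ := coshTest_admissible b₁
  have hCs₂ : ∀ x, x ∉ Icc (-b₂) b₂ → (Icc (-b₁) b₁).indicator (fun y ↦ Real.cosh (y / 2)) x = 0 :=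
    fun x hx ↦ hCs x fun hm ↦ hx ⟨by linarith only [hm.1, hb₁₂], by linarith only [hm.2, hb₁₂]⟩
  obtain ⟨hC2m, hC2b, hC2s⟩ := coshTest_admissible b₂
  have h2 := integral_sq_sub_le_two_mul_add (B := b₂) hC2m hCm hCm_ hC2b hCmb hCb hC2s hCms hCs₂
  have h3 := integral_sq_coshProfile_sub_coshProfile_le hb₁₂
  rw [show 2 * (b₂ - b₁) = 2 * s ^ 2 by rw [hb₂]; ring] at h3
  have h4 : Real.cosh (b₂ / 2) ^ 2 ≤ Pp := by
    have h5 := pow_le_pow_left₀ (Real.cosh_pos _).le (cosh_half_le_sqrt (b := b₂) (hb₁1.trans hb₁₂)) 2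
    have hP2 : 0 ≤ b₂ + Real.sinh b₂ := by
      have := Real.self_le_sinh_iff.2 (show (0 : ℝ) ≤ b₂ by linarith only [hb₁1, hb₁₂])
      linarith only [this, hb₁1, hb₁₂]
    rw [Real.sq_sqrt hP2] at h5
    exact h5.trans hPp
  have hP₁P : P₁ ≤ Pp := by rw [hP₁]; exact le_trans (add_le_add hb₁₂ (Real.sinh_le_sinh.2 hb₁₂)) hPp
  have h4' : 2 * s ^ 2 * Real.cosh (b₂ / 2) ^ 2 ≤ 2 * s ^ 2 * Pp := mul_le_mul_of_nonneg_left h4 (by positivity)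
  have h6 : ∫ x, ((Icc (-b₂) b₂).indicator (fun y ↦ Real.cosh (y / 2)) x - Cm x) ^ 2 ≤ 8 * s ^ 2 * Pp := by
    have h7 : (P₁ + 3) * s ^ 2 ≤ 2 * s ^ 2 * Pp := by nlinarith only [hP₁P, hP₁3, hs2]
    linarith only [h2, h3, hdist', h4', h7]
  exact h1.trans (mul_le_mul_of_nonneg_left h6 (integral_nonneg fun x ↦ sq_nonneg _))

/-- PIECE: **the archimedean energy of the residual**, `ARCH(r) ≤ 10ηN + 4Ψ(ηh)‖r‖²` — the residual inherits a linear small-scale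
modulus (`residual_increment_le`), then `archEnergy_le_of_linear_smallScale` with the cut `t₀ = ηh`. -/
theorem arch_term_le (hh0 : 0 < h) (hh1 : h ≤ 1) (hη0 : 0 < η) (hη1 : η ≤ 1) (hP₁3 : 3 ≤ P₁)
    (hCm : Measurable Cm) (hCmb : ∀ x, |Cm x| ≤ CCm) (hCms : ∀ x, x ∉ Icc (-b₂) b₂ → Cm x = 0)
    (hu : Measurable u) (hCu : ∀ x, |u x| ≤ Cu) (hus : ∀ x, x ∉ Icc (-b₂) b₂ → u x = 0)
    (hrW : IsWeilTest fun x ↦ ((u x - c * Cm x : ℝ) : ℂ))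
    (hrT : tsupport (fun x ↦ ((u x - c * Cm x : ℝ) : ℂ)) ⊆ Icc (-b₂) b₂)
    (hmod : ∀ t, ∫ x, (u (x + t) - u x) ^ 2 ≤ |t| / h * N)
    (hmodf : ∀ t ∈ Ioc (0 : ℝ) 1, ∫ x, (Cm (x + t) - Cm x) ^ 2 ≤ (P₁ + 3) * t)
    (hN : 0 ≤ N) (huN : Nu ≤ N) (hNu0 : 0 ≤ Nu) (hBes : c ^ 2 * Pm ≤ Nu) (hPm2 : P₁ ≤ 2 * Pm) :
    ∫ t in Ioi 0, weilArchDensity t * ∫ x, ((u (x + t) - c * Cm (x + t)) - (u x - c * Cm x)) ^ 2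
      ≤ 10 * η * N + 4 * weilArchTail (η * h) * ∫ x, (u x - c * Cm x) ^ 2 := by
  have ht₀ : 0 < η * h := by positivity
  have ht₀1 : η * h ≤ 1 := by
    calc η * h ≤ 1 * 1 := mul_le_mul hη1 hh1 hh0.le zero_le_one
      _ = 1 := one_mul 1
  have hM0 : 0 ≤ 2 * N / h + 2 * c ^ 2 * (P₁ + 3) := by
    have : 0 ≤ P₁ + 3 := by linarith only [hP₁3]
    positivity
  have hmodr : ∀ t ∈ Ioc 0 (η * h), ∫ x, ((u (x + t) - c * Cm (x + t)) - (u x - c * Cm x)) ^ 2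
      ≤ (2 * N / h + 2 * c ^ 2 * (P₁ + 3)) * t := fun t ht ↦
    residual_increment_le (B := b₂) hu hCm hCu hCmb hus hCms hh0 hmod hmodf c ⟨ht.1, ht.2.trans ht₀1⟩
  obtain ⟨-, hle⟩ := archEnergy_le_of_linear_smallScale (r := fun x ↦ u x - c * Cm x) hrW hrT ht₀ ht₀1 hM0 hmodr
  refine hle.trans ?_
  have h1 : c ^ 2 * (P₁ + 3) ≤ 4 * Nu := by
    have e1 : c ^ 2 * 3 ≤ c ^ 2 * P₁ := mul_le_mul_of_nonneg_left hP₁3 (sq_nonneg c)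
    have e2 : c ^ 2 * P₁ ≤ c ^ 2 * (2 * Pm) := mul_le_mul_of_nonneg_left hPm2 (sq_nonneg c)
    linarith only [e1, e2, hBes]
  have h2 : (2 * N / h + 2 * c ^ 2 * (P₁ + 3)) * (η * h) = 2 * η * N + 2 * (η * h) * (c ^ 2 * (P₁ + 3)) := by
    field_simp
  rw [h2]
  have h3 : 2 * (η * h) * (c ^ 2 * (P₁ + 3)) ≤ 2 * (η * h) * (4 * Nu) :=
    mul_le_mul_of_nonneg_left h1 (by positivity)
  have h4 : (η * h) * Nu ≤ η * Nu := by
    have : η * h ≤ η := by nlinarith only [hη0, hh1]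
    exact mul_le_mul_of_nonneg_right this hNu0
  have h5 : η * Nu ≤ η * N := mul_le_mul_of_nonneg_left huN hη0.le
  linarith only [h3, h4, h5]

/-- PIECE: **the mollified profile keeps half the norm**, `‖C‖² ≤ 2‖C_m‖²` when `‖C − C_m‖ ≤ (3/2)s‖C‖`, `s ≤ 1/6`. -/
theorem profile_norm_ge_half (hs1 : s ≤ 1 / 6) (hP₁0 : 0 < P₁)
    (hC : Measurable C) (hCb : ∀ x, |C x| ≤ CC) (hCs : ∀ x, x ∉ Icc (-b₂) b₂ → C x = 0)
    (hCm : Measurable Cm) (hCmb : ∀ x, |Cm x| ≤ CCm) (hCms : ∀ x, x ∉ Icc (-b₂) b₂ → Cm x = 0)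
    (hCP : ∫ x, C x ^ 2 = P₁) (hCmN : ∫ x, Cm x ^ 2 ≤ ∫ x, C x ^ 2)
    (hsqd : Real.sqrt (∫ x, (C x - Cm x) ^ 2) ≤ 3 / 2 * s * Real.sqrt P₁) :
    P₁ ≤ 2 * ∫ x, Cm x ^ 2 := by
  have h1 := integral_sq_ge_of_near (B := b₂) hC hCm hCb hCmb hCs hCms hCmN
  rw [hCP] at h1
  have hsPsq : Real.sqrt P₁ * Real.sqrt P₁ = P₁ := Real.mul_self_sqrt hP₁0.le
  have h2 : 2 * Real.sqrt P₁ * Real.sqrt (∫ x, (C x - Cm x) ^ 2) ≤ 3 * s * P₁ := by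
    calc 2 * Real.sqrt P₁ * Real.sqrt (∫ x, (C x - Cm x) ^ 2) ≤ 2 * Real.sqrt P₁ * (3 / 2 * s * Real.sqrt P₁) :=
          mul_le_mul_of_nonneg_left hsqd (by positivity)
      _ = 3 * s * (Real.sqrt P₁ * Real.sqrt P₁) := by ring
      _ = 3 * s * P₁ := by rw [hsPsq]
  have h3 : 3 * s * P₁ ≤ P₁ / 2 := by nlinarith only [hs1, hP₁0]
  linarith only [h1, h2, h3]

/-- PIECE: **the residual's energy against the rigidity of the ORIGINAL profile**,
`‖r‖² ≤ (∫u² − ⟨u,C⟩²/‖C‖²) + (9/2)s∫u²` (`residual_sq_le_offProfile_add`). -/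
theorem residual_energy_le (hs36 : s ^ 2 ≤ 1 / 36) (hP₁0 : 0 < P₁) (hP₁3 : 3 ≤ P₁)
    (hC : Measurable C) (hCb : ∀ x, |C x| ≤ CC) (hCs : ∀ x, x ∉ Icc (-b₂) b₂ → C x = 0)
    (hCm : Measurable Cm) (hCmb : ∀ x, |Cm x| ≤ CCm) (hCms : ∀ x, x ∉ Icc (-b₂) b₂ → Cm x = 0)
    (hu : Measurable u) (hCu : ∀ x, |u x| ≤ Cu) (hus : ∀ x, x ∉ Icc (-b₂) b₂ → u x = 0)
    (hCP : ∫ x, C x ^ 2 = P₁) (hPm0 : 0 < ∫ x, Cm x ^ 2) (hCmN : ∫ x, Cm x ^ 2 ≤ ∫ x, C x ^ 2)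
    (hdist' : ∫ x, (C x - Cm x) ^ 2 ≤ (P₁ + 3) * s ^ 2)
    (hsqd : Real.sqrt (∫ x, (C x - Cm x) ^ 2) ≤ 3 / 2 * s * Real.sqrt P₁) :
    ∫ x, (u x - (∫ y, u y * Cm y) / (∫ y, Cm y ^ 2) * Cm x) ^ 2
      ≤ ((∫ x, u x ^ 2) - (∫ x, u x * C x) ^ 2 / P₁) + 9 / 2 * s * ∫ x, u x ^ 2 := by
  have h1 := residual_sq_le_offProfile_add (B := b₂) hu hC hCm hCu hCb hCmb hus hCs hCms hPm0 hCmN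
    (hdist'.trans (by rw [hCP]; nlinarith only [hs36, hP₁3, hP₁0]))
  rw [hCP] at h1
  have hsP : 0 < Real.sqrt P₁ := Real.sqrt_pos.2 hP₁0
  have hNu0 : 0 ≤ ∫ x, u x ^ 2 := integral_nonneg fun x ↦ sq_nonneg _
  have h2 : 3 * (∫ x, u x ^ 2) * Real.sqrt (∫ x, (C x - Cm x) ^ 2) / Real.sqrt P₁ ≤ 9 / 2 * s * ∫ x, u x ^ 2 := by
    rw [div_le_iff₀ hsP]
    have := mul_le_mul_of_nonneg_left hsqd (by positivity : (0 : ℝ) ≤ 3 * ∫ x, u x ^ 2)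
    nlinarith only [this]
  linarith only [h1, h2]

end Pieces

end FloorCoshSplit

end Summit.RiemannHypothesis.RiemannHypothesis.Theorems.WeilFormatC
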